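import Mathlib.Algebra.BigOperators.Fin
import Summits.CriticalPhenomena.PercolationContinuityZ3.Theorems.PercNearOneGluingNoHeavyLowerTailSahiPairSaturation
import Summits.CriticalPhenomena.PercolationContinuityZ3.Theorems.PercNearOneGluingNoHeavyLowerTailSahiPair43Check
import Summits.CriticalPhenomena.PercolationContinuityZ3.Theorems.PercNearOneGluingNoHeavyLowerTailSahiSlotCell34Facts

/-!
# `NoHeavyLowerTail` (crux stmt-CriticalPhenomena-4575), Sahi programme: the cell `(4,3)` — **link, scalar part**: the encoded
# y-profile is the y-profile, and the one-pair transport test is sound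

Support file (Sahi cell `prim-sahi`, seat `prim-sahi-typer` gen 31–32; `--supports stmt-CriticalPhenomena-4575`).  Pure proofs plus the
bookkeeping definitions `enc` (code of a point of `[3]^4`), `Rep` (a mask represents a finset) and `InDualArr`; no `sorry`, standard axioms.
(Table reads use `SahiSlot34.getD_ofFn` of `…SahiSlotCell34Facts`.)

* `dg_enc`, `leC_enc`, `tdC_enc`, `thirdC_enc`: the digit/comparison/third-point functions of `…SahiPair43Check` agree with the
  coordinates, the order, `TotDist` and `thirdPt` of `…SahiGridPatternSliceForm` under the encoding `enc p = Σ_a p_a 3^a`.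
* `profileArr_enc`: if the masks `a, b` represent the finsets `A, B` (`Rep`), then `(profileArr a b)[enc y] = yProfile A B y`
  (via `yProfile_eq`).
* `inDualArr_of_applyPlan`, `dualTest_sound`: a transport plan that makes an array pointwise nonnegative proves that the array (read
  through `enc`) lies in the dual cone of the up-sets — every applied step is a downward transfer (`inDual_of_transfer`); hence
  **`pairTest_sound`**: `pairTest a b = true → InDual (yProfile A B)`. [this work]
-/

namespace Summit.CriticalPhenomena.PercolationContinuityZ3.Theorems.SahiGridPattern.Pair43

open Finset SahiGrid3 SahiGridPattern
open scoped BigOperators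

/-! ### The encoding -/

/-- The code of a point of `[3]^4`: `Σ_a p_a 3^a`. [this work] -/
def enc (p : Pd 4) : ℕ := ((finFunctionFinEquiv p : Fin (3 ^ 4)) : ℕ)

/-- Codes are `< 81`. [this work] -/
theorem enc_lt (p : Pd 4) : enc p < 81 := (finFunctionFinEquiv p).isLt

/-- `enc` is injective. [this work] -/
theorem enc_injective : Function.Injective enc := fun _ _ h =>
  finFunctionFinEquiv.injective (Fin.ext h)

/-- Every code `< 81` is the code of a point. [this work] -/
theorem exists_enc_eq {k : ℕ} (hk : k < 81) : ∃ p : Pd 4, enc p = k :=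
  ⟨finFunctionFinEquiv.symm ⟨k, hk⟩, by unfold enc; rw [Equiv.apply_symm_apply]⟩

/-- The digits of a code are the coordinates. [this work] -/
theorem dg_enc (p : Pd 4) (a : Fin 4) : dg (enc p) a = (p a : ℕ) := by
  have h := congrArg (fun g : Pd 4 => (g a : ℕ)) ((finFunctionFinEquiv : (Pd 4) ≃ Fin (3 ^ 4)).symm_apply_apply p)
  simp only [finFunctionFinEquiv_symm_apply_val] at h
  have hd : dg (enc p) a = enc p / 3 ^ (a : ℕ) % 3 := by
    unfold dg; fin_cases a <;> simp
  rw [hd]; exact h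

/-- Digit 0. [this work] -/
theorem dg_enc0 (p : Pd 4) : dg (enc p) 0 = (p 0 : ℕ) := dg_enc p 0
/-- Digit 1. [this work] -/
theorem dg_enc1 (p : Pd 4) : dg (enc p) 1 = (p 1 : ℕ) := dg_enc p 1
/-- Digit 2. [this work] -/
theorem dg_enc2 (p : Pd 4) : dg (enc p) 2 = (p 2 : ℕ) := dg_enc p 2
/-- Digit 3. [this work] -/
theorem dg_enc3 (p : Pd 4) : dg (enc p) 3 = (p 3 : ℕ) := dg_enc p 3

/-- A property of all four coordinates. [this work] -/
theorem forall_fin4 {P : Fin 4 → Prop} : (∀ a, P a) ↔ P 0 ∧ P 1 ∧ P 2 ∧ P 3 :=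
  ⟨fun h => ⟨h 0, h 1, h 2, h 3⟩, fun h a => by
    fin_cases a
    exacts [h.1, h.2.1, h.2.2.1, h.2.2.2]⟩

/-- `leC` decides the coordinatewise order. [this work] -/
theorem leC_enc (p q : Pd 4) : leC (enc p) (enc q) = true ↔ p ≤ q := by
  unfold leC
  simp only [Bool.and_eq_true, decide_eq_true_eq, dg_enc0, dg_enc1, dg_enc2, dg_enc3, Fin.val_fin_le]
  rw [Pi.le_def, forall_fin4]
  tauto

/-- `leC` as a Boolean equation. [this work] -/
theorem leC_enc_eq_false (p q : Pd 4) : leC (enc p) (enc q) = false ↔ ¬ p ≤ q := by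
  rw [← leC_enc]; simp

/-- `tdC` decides total distinctness. [this work] -/
theorem tdC_enc (p q : Pd 4) : tdC (enc p) (enc q) = TotDist p q := by
  have h : tdC (enc p) (enc q) = true ↔ ∀ a, p a ≠ q a := by
    unfold tdC
    simp only [Bool.and_eq_true, bne_iff_ne, ne_eq, dg_enc0, dg_enc1, dg_enc2, dg_enc3, Fin.val_inj]
    rw [forall_fin4]
    tauto
  by_cases hpq : ∀ a, p a ≠ q a
  · rw [h.2 hpq]; exact (totDist_iff.2 hpq).symm
  · have h1 : tdC (enc p) (enc q) = false := by
      cases ht : tdC (enc p) (enc q)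
      · rfl
      · exact absurd (h.1 ht) hpq
    have h2 : TotDist p q = false := by
      cases ht : TotDist p q
      · rfl
      · exact absurd (totDist_iff.1 ht) hpq
    rw [h1, h2]

/-- The code as an explicit digit sum. [this work] -/
theorem enc_eq_sum (p : Pd 4) : enc p = (p 0 : ℕ) + (p 1 : ℕ) * 3 + (p 2 : ℕ) * 9 + (p 3 : ℕ) * 27 := by
  unfold enc
  rw [finFunctionFinEquiv_apply, Fin.sum_univ_four]
  simp

/-- Per-axis value of the third point. [this work] -/
theorem thirdPt_val (u v : Fin 3) : ((-(u + v) : Fin 3) : ℕ) = (6 - (u : ℕ) - (v : ℕ)) % 3 := by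
  revert u v; decide

/-- `thirdC` computes the code of the third point of a Latin line. [this work] -/
theorem thirdC_enc (p q : Pd 4) : thirdC (enc p) (enc q) = enc (thirdPt p q) := by
  unfold thirdC
  rw [dg_enc0, dg_enc1, dg_enc2, dg_enc3, dg_enc0, dg_enc1, dg_enc2, dg_enc3, enc_eq_sum (thirdPt p q)]
  unfold thirdPt
  simp only [thirdPt_val]

/-! ### Sums over the points as sums over the codes -/

/-- A sum over `[3]^4` is a sum over the codes `< 81`. [this work] -/
theorem sum_enc_eq_sum_range (g : ℕ → ℤ) : ∑ p : Pd 4, g (enc p) = ∑ k ∈ range 81, g k := by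
  unfold enc
  rw [← Equiv.sum_comp (finFunctionFinEquiv : (Pd 4) ≃ Fin (3 ^ 4)).symm (fun p => g ((finFunctionFinEquiv p : Fin (3^4)) : ℕ))]
  simp only [Equiv.apply_symm_apply]
  exact (Fin.sum_univ_eq_sum_range (fun k => g k) (3 ^ 4))

/-! ### Masks representing finsets -/

/-- `Rep a A`: bit `enc p` of the mask `a` is set iff `p ∈ A`. [this work] -/
def Rep (a : ℕ) (A : Finset (Pd 4)) : Prop := ∀ p : Pd 4, a.testBit (enc p) = decide (p ∈ A)

/-- The indicator array of a representing mask. [this work] -/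
theorem indArr_enc {a : ℕ} {A : Finset (Pd 4)} (h : Rep a A) (p : Pd 4) : (indArr a).getD (enc p) 0 = ind A p := by
  unfold indArr
  rw [SahiSlot34.getD_ofFn _ _ (enc_lt p)]
  simp only [h p]
  unfold ind
  by_cases hp : p ∈ A <;> simp [hp]

/-! ### The profile -/

/-- `Array.foldl` of an additive step over a mapped list is a list sum. [this work] -/
theorem foldl_add_eq_sum {β : Type} (l : List β) (h : β → ℤ) (s : ℤ) :
    l.foldl (fun acc x => acc + h x) s = s + (l.map h).sum := by
  induction l generalizing s with
  | nil => simp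
  | cons x rest ih => simp [List.foldl_cons, ih, add_assoc]

/-- The table `tdL` at a code: the filtered-and-mapped list. [this work] -/
theorem tdL_getD (p : Pd 4) :
    tdL.getD (enc p) #[] = (((List.range 81).filter fun q => tdC q (enc p)).map fun q => (q, thirdC q (enc p))).toArray := by
  unfold tdL; rw [SahiSlot34.getD_ofFn _ _ (enc_lt p)]

/-- Sum of a map over a filtered list as a sum with an indicator. [this work] -/
theorem sum_map_filter_eq {β : Type} (l : List β) (p : β → Bool) (f : β → ℤ) :
    ((l.filter p).map f).sum = (l.map fun x => if p x = true then f x else 0).sum := by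
  induction l with
  | nil => simp
  | cons x rest ih =>
    rw [List.filter_cons]
    by_cases hx : p x = true
    · simp [hx, ih]
    · simp [hx, ih]

/-- A sum over `List.range n` is a `Finset.range` sum. [this work] -/
theorem sum_map_range_eq (n : ℕ) (g : ℕ → ℤ) : ((List.range n).map g).sum = ∑ k ∈ range n, g k := by
  induction n with
  | zero => simp
  | succ n ih => rw [List.range_succ, List.map_append, List.sum_append, ih, Finset.sum_range_succ]; simp

/-- The two folds of `profileAt` over the table `tdL[enc y]` as sums over the points totally distinct from `y`. [this work] -/
theorem foldl_tdL_eq (y : Pd 4) (h : ℕ × ℕ → ℤ) (g : Pd 4 → ℤ)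
    (hg : ∀ q : Pd 4, h (enc q, thirdC (enc q) (enc y)) = g q) :
    (tdL.getD (enc y) #[]).foldl (fun s qt => s + h qt) 0 = ∑ q : Pd 4, if TotDist q y = true then g q else 0 := by
  rw [tdL_getD, List.foldl_toArray, foldl_add_eq_sum, zero_add, List.map_map, sum_map_filter_eq, sum_map_range_eq,
    ← sum_enc_eq_sum_range]
  refine Finset.sum_congr rfl fun q _ => ?_
  simp only [Function.comp, tdC_enc, hg]

/-- `nuCount` as an indicator sum. [this work] -/
theorem nuCount_eq_sum (A : Finset (Pd 4)) (y : Pd 4) :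
    (nuCount A y : ℤ) = ∑ q : Pd 4, if TotDist q y = true then ind A q else 0 := by
  unfold nuCount
  rw [Finset.card_filter]
  push_cast
  have h : ∀ q ∈ (univ : Finset (Pd 4)), (if TotDist q y = true then ind A q else 0) =
      (if q ∈ A then (if TotDist q y = true then (1 : ℤ) else 0) else 0) := by
    intro q _; unfold ind; by_cases hq : q ∈ A <;> by_cases ht : TotDist q y = true <;> simp [hq, ht]
  rw [Finset.sum_congr rfl h, Finset.sum_ite_mem, Finset.univ_inter]

/-- `Σ_{q∈B} Θ_A(q,y)` as an indicator sum. [this work] -/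
theorem sum_thetaVal_eq_sum (A B : Finset (Pd 4)) (y : Pd 4) :
    ∑ q ∈ B, thetaVal A q y = ∑ q : Pd 4, if TotDist q y = true then ind B q * (ind A q + ind A y - ind A (thirdPt q y)) else 0 := by
  rw [← Finset.sum_ite_mem_eq B]
  refine Finset.sum_congr rfl fun q _ => ?_
  unfold thetaVal ind
  by_cases hq : q ∈ B <;> by_cases ht : TotDist q y = true <;> simp [hq, ht]

/-- **The encoded profile is the y-profile.** [this work] -/
theorem profileArr_enc {a b : ℕ} {A B : Finset (Pd 4)} (ha : Rep a A) (hb : Rep b B) (y : Pd 4) :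
    (profileArr a b).getD (enc y) 0 = yProfile A B y := by
  unfold profileArr
  rw [SahiSlot34.getD_ofFn _ _ (enc_lt y)]
  show profileAt (indArr a) (indArr b) (enc y) = yProfile A B y
  unfold profileAt
  simp only []
  rw [foldl_tdL_eq y (fun qt => (indArr a).getD qt.1 0) (fun q => ind A q) (fun q => by simp [indArr_enc ha]),
    foldl_tdL_eq y (fun qt => (indArr b).getD qt.1 0 * ((indArr a).getD qt.1 0 + (indArr a).getD (enc y) 0 - (indArr a).getD qt.2 0))
      (fun q => ind B q * (ind A q + ind A y - ind A (thirdPt q y)))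
      (fun q => by simp only [thirdC_enc, indArr_enc ha, indArr_enc hb]),
    indArr_enc ha, indArr_enc hb, yProfile_eq, nuCount_eq_sum, sum_thetaVal_eq_sum]
  have h32 : (2 : ℤ) * 2 ^ 4 = 32 := by norm_num
  rw [h32]
  unfold ind
  by_cases hy : y ∈ B <;> simp [hy]

/-! ### Soundness of the one-pair transport test -/

/-- The array, read through the encoding, lies in the dual cone of the up-sets. [this work] -/
def InDualArr (c : Array ℤ) : Prop := InDual (fun y : Pd 4 => c.getD (enc y) 0)

/-- `applyStep` preserves the size. [this work] -/
theorem size_applyStep (c : Array ℤ) (w y amt : ℕ) : (applyStep c w y amt).size = c.size := by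
  unfold applyStep; split <;> simp

/-- `applyPlan` preserves the size. [this work] -/
theorem size_applyPlan (c : Array ℤ) (plan : List (ℕ × ℕ × ℕ)) : (applyPlan c plan).size = c.size := by
  induction plan generalizing c with
  | nil => rfl
  | cons s rest ih => obtain ⟨w, y, amt⟩ := s; show (applyPlan (applyStep c w y amt) rest).size = _; rw [ih, size_applyStep]

/-- Reading an entry after `setIfInBounds`. [this work] -/
theorem getD_setIfInBounds (c : Array ℤ) {i : ℕ} (hi : i < c.size) (v : ℤ) (j : ℕ) :
    (c.setIfInBounds i v).getD j 0 = if i = j then v else c.getD j 0 := by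
  rw [Array.getD_eq_getD_getElem?, Array.getElem?_setIfInBounds, Array.getD_eq_getD_getElem?]
  by_cases h : i = j
  · subst h; simp [hi]
  · simp [h]

/-- **One applied step is a downward transfer** (or nothing). [this work] -/
theorem inDualArr_of_applyStep {c : Array ℤ} (hc : c.size = 81) (w y amt : ℕ) (h : InDualArr (applyStep c w y amt)) :
    InDualArr c := by
  unfold applyStep at h
  by_cases hcond : (leC y w && decide (w < 81) && decide (y < 81)) = true
  · rw [if_pos hcond] at h
    simp only [Bool.and_eq_true, decide_eq_true_eq] at hcond
    obtain ⟨⟨hle, hw⟩, hy⟩ := hcond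
    obtain ⟨pw, rfl⟩ := exists_enc_eq hw
    obtain ⟨py, rfl⟩ := exists_enc_eq hy
    have hle' : py ≤ pw := (leC_enc py pw).1 hle
    refine inDual_of_transfer hle' (Int.natCast_nonneg amt) ?_
    unfold InDualArr at h
    have hw81 : enc pw < c.size := hc ▸ enc_lt pw
    have hy81 : enc py < (c.setIfInBounds (enc pw) (c.getD (enc pw) 0 - amt)).size := by simp [hc, enc_lt]
    convert h using 1
    funext z
    unfold transfer
    rw [getD_setIfInBounds _ hy81, getD_setIfInBounds _ hw81, getD_setIfInBounds _ hw81]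
    by_cases h1 : enc py = enc z
    · rw [if_pos h1]
      have hz : z = py := (enc_injective h1).symm
      subst hz
      by_cases h2 : enc pw = enc z
      · rw [if_pos h2]; have := (enc_injective h2); subst this; simp
      · rw [if_neg h2]; have : z ≠ pw := fun e => h2 (by rw [e]); simp [this]
    · rw [if_neg h1]
      have hz : z ≠ py := fun e => h1 (by rw [e])
      by_cases h2 : enc pw = enc z
      · rw [if_pos h2]; have := (enc_injective h2); subst this; simp [hz]
      · rw [if_neg h2]; have : z ≠ pw := fun e => h2 (by rw [e]); simp [this, hz]
  · rw [if_neg hcond] at h; exact h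

/-- **An applied plan only helps**: if the result lies in the dual cone, so does the original array. [this work] -/
theorem inDualArr_of_applyPlan {c : Array ℤ} (hc : c.size = 81) (plan : List (ℕ × ℕ × ℕ)) (h : InDualArr (applyPlan c plan)) :
    InDualArr c := by
  induction plan generalizing c with
  | nil => exact h
  | cons s rest ih =>
    obtain ⟨w, y, amt⟩ := s
    exact inDualArr_of_applyStep hc w y amt (ih (by rw [size_applyStep, hc]) h)

/-- `allBelow` semantics. [this work] -/
theorem allBelow_iff (n : ℕ) (p : ℕ → Bool) : allBelow n p = true ↔ ∀ k < n, p k = true := by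
  induction n with
  | zero => simp [allBelow]
  | succ n ih =>
    show (allBelow n p && p n) = true ↔ _
    rw [Bool.and_eq_true, ih]
    constructor
    · rintro ⟨h1, h2⟩ k hk
      rcases Nat.lt_succ_iff_lt_or_eq.1 hk with hk | rfl
      exacts [h1 k hk, h2]
    · intro h; exact ⟨fun k hk => h k (Nat.lt_succ_of_lt hk), h n (Nat.lt_succ_self n)⟩

/-- A pointwise nonnegative array lies in the dual cone. [this work] -/
theorem inDualArr_of_allNonneg {c : Array ℤ} (h : allNonneg c = true) : InDualArr c := by
  unfold allNonneg at h
  rw [allBelow_iff] at h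
  exact inDual_of_nonneg fun y => by have := h (enc y) (enc_lt y); simpa using this

/-- **Soundness of `dualTest`.** [this work] -/
theorem dualTest_sound {c : Array ℤ} (hc : c.size = 81) (h : dualTest c = true) : InDualArr c := by
  unfold dualTest at h
  rw [Bool.or_eq_true] at h
  rcases h with h | h
  · exact inDualArr_of_applyPlan hc _ (inDualArr_of_allNonneg h)
  · exact inDualArr_of_applyPlan hc _ (inDualArr_of_allNonneg h)

/-- **Soundness of the one-pair test**: if the masks represent `A, B`, then `pairTest a b = true` puts the y-profile of `(A,B)`
in the dual cone of the up-sets. [this work] -/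
theorem pairTest_sound {a b : ℕ} {A B : Finset (Pd 4)} (ha : Rep a A) (hb : Rep b B) (h : pairTest a b = true) :
    InDual (yProfile A B) := by
  have hsize : (profileArr a b).size = 81 := by unfold profileArr; simp
  have h1 : InDualArr (profileArr a b) := dualTest_sound hsize h
  unfold InDualArr at h1
  have h2 : (fun y : Pd 4 => (profileArr a b).getD (enc y) 0) = yProfile A B := funext fun y => profileArr_enc ha hb y
  rwa [h2] at h1

end Summit.CriticalPhenomena.PercolationContinuityZ3.Theorems.SahiGridPattern.Pair43
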